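import Mathlib
import HarnessLib
import Literature.Analysis.FluidPDE.Seregin2020AncientLimitAlong
import Summits.NavierStokesRegularity.NavierStokesRegularity.Theorems.AxisTwistDoorAveragedConeLiouvilleProfileZoomFrame
import Summits.NavierStokesRegularity.NavierStokesRegularity.Theorems.AxisTwistDoorTiltDominationLocEnergyClass

/-!
# AxisTwistDoor · crux `TiltDominationLoc` (stmt-NavierStokesRegularity-26991), line «signcone» — APEX-ZOOM LIMITS OF A
# BACKWARD-SINGULAR PROFILE ARE BACKWARD-SINGULAR (along ANY null sequence of scales)

Helper file (`--supports stmt-NavierStokesRegularity-26991 --as helper`; seat ns-imp-p1 g5, DIRECTOR-NS #244 (4); line author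
ns-idea-6 g7, LEAD of record ns-atd-p1).  No definitions.

* `isBackwardSingularPoint_of_zoomLimit` — let `v` be a profile of the core class (Type-I rate, continuity on the open backward
  slab, unit-viscosity Oseen identity, divergence-free slices) which is backward-singular at the apex `(0,0)`, and let
  `μₙ → 0⁺` be ANY null sequence of scales.  If the apex zooms `μₙ v(μₙ² t, μₙ x)` converge pointwise on the open slab to a
  field `W`, then `W` is backward-singular at `(0,0)`.

Proof.  The energy class of `v` is automatic (`…TiltDominationLocEnergyClass.exists_energyClass_of_typeI`); the inputs of
Seregin's zoom-in extraction at the singular vertex are assembled VERBATIM as in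
`…AveragedConeLiouvilleProfileZoom.profileZoomFrame` (steps (1)–(5) there: pressure normalised to unit-ball mean zero, the
profile as a suitable weak solution in `Q(0,2) ⊇ 𝒞 × (−1,0)`, `L^{3/2}` pressure, finite blow-up index); Seregin's extraction
ALONG THE PRESCRIBED SCALES (`Literature…Seregin2020.exists_ancientLimit_along`, floor `κ₀ = 0`) gives a subsequence and an
`L³_loc` limit `w` on every `Q(0,a)` which is backward-singular; `L³` convergence gives an a.e.-convergent sub-subsequence
(`tendstoInMeasure_of_tendsto_eLpNorm`, `TendstoInMeasure.exists_seq_tendsto_ae`), so `w = W` a.e. on every `Q(0,a)` by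
uniqueness of pointwise limits, and essential unboundedness on the cylinders `Q(0,r)` transfers to `W`.

HONEST FRAMING: a compactness lemma about HYPOTHETICAL Type-I blow-up profiles; nothing here bears on Navier–Stokes regularity
(Clay A OPEN), on the crux 26991 or on the wall `StubRayRigidity`.
-/

noncomputable section

-- the summit and its single sub-problem share the name (CONVENTIONS §1), as in every Theorems file
set_option linter.dupNamespace false

namespace Summit.NavierStokesRegularity.NavierStokesRegularity.Theorems.AxisTwistDoorSignConeZoomSingular

open MeasureTheory Set Function Filter Topology TopologicalSpace Metric
open Literature.Analysis Literature.Analysis.FluidPDE Literature.Analysis.FluidPDE.SereginSverak2009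
open Summit.NavierStokesRegularity.NavierStokesRegularity.Theorems
open scoped NNReal ENNReal

/-- **Apex-zoom limits of a backward-singular core profile are backward-singular**, along any null sequence of scales (module
docstring). [cite: Seregin2020, proof of Thm. 2.1, (2.8)–(2.9)] [cite: AlbrittonBarker2019, Prop. 2.3] -/
theorem isBackwardSingularPoint_of_zoomLimit {C : ℝ} {v : ℝ → EuclideanSpace ℝ (Fin 3) → EuclideanSpace ℝ (Fin 3)}
    (hrate : HasTypeITimeDecay C v) (hcont : ContinuousOn (uncurry v) (Iio (0 : ℝ) ×ˢ univ))
    (hmild : ∀ s t : ℝ, s < t → t < 0 → ∀ x,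
      v t x = UnboundedOperators.heatExtension (v s) (t - s) x - oseenDuhamel 1 s v v t x)
    (hdiv : ∀ t < 0, VectorCalculus.IsDivFree (v t))
    (hsing' : IsBackwardSingularPoint v (0 : ℝ × EuclideanSpace ℝ (Fin 3)))
    {μ : ℕ → ℝ} (hμ : ∀ n, 0 < μ n) (hμ0 : Tendsto μ atTop (𝓝 0))
    {W : ℝ → EuclideanSpace ℝ (Fin 3) → EuclideanSpace ℝ (Fin 3)}
    (hcv : ∀ t < (0 : ℝ), ∀ x, Tendsto (fun n => nsRescale (μ n) v t x) atTop (𝓝 (W t x))) :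
    IsBackwardSingularPoint W (0 : ℝ × EuclideanSpace ℝ (Fin 3)) := by
  -- ## (1) the energy class of `v` is automatic
  obtain ⟨π, H, hsw, hwg, hI⟩ :=
    AxisTwistDoorTiltDominationLocEnergyClass.exists_energyClass_of_typeI hrate hcont hmild hdiv
  have hItop : typeIBound (Iio (0 : ℝ) ×ˢ univ) v π H ≠ ⊤ := hI.ne
  -- ## (2) pressure normalised to unit-ball mean zero (as in `profileZoomFrame`)
  set πn : ℝ → EuclideanSpace ℝ (Fin 3) → ℝ := fun t x => π t x - ⨍ y in ball (0 : EuclideanSpace ℝ (Fin 3)) 1, π t y with hπn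
  have hswn : IsSuitableWeakSolutionOn (slab (EuclideanSpace ℝ (Fin 3)) (Iio 0) isOpen_Iio) 1 0 v πn := hsw.sub_unitBallMean_slab
  have hIn : typeIBound (Iio (0 : ℝ) ×ˢ univ) v πn H = typeIBound (Iio (0 : ℝ) ×ˢ univ) v π H := by
    show typeIBound (Iio (0 : ℝ) ×ˢ univ) v (fun t x => π t x - ⨍ y in ball (0 : EuclideanSpace ℝ (Fin 3)) 1, π t y) H = _
    rw [typeIBound_sub_unitBallMean hsw.distributional.2.2.1]
  have h0n : ∀ t, ⨍ y in ball (0 : EuclideanSpace ℝ (Fin 3)) 1, πn t y = 0 := fun t => unitBallMean_sub_unitBallMean π t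
  have hIn' : typeIBound (Iio (0 : ℝ) ×ˢ univ) v πn H ≠ ⊤ := by rw [hIn]; exact hItop
  -- ## (3) the profile in the balls `Q(0,2) ⊇ Q(0,1)`
  have hball' : IsSuitableWeakSolutionInBall 2 0 v πn := isSuitableWeakSolutionInBall_of_slab hswn hwg hIn' h0n (by norm_num)
  have hH0 : HasWeakSpatialGradientOn (parabolicCylinderOpens 2 (0 : ℝ × EuclideanSpace ℝ (Fin 3))) v H :=
    hwg.mono (parabolicCylinderOpens_le_slab 2 (le_refl (0 : ℝ)))
  have hI' : typeIBound (parabolicCylinder 1 (0 : ℝ × EuclideanSpace ℝ (Fin 3))) v πn H < ⊤ := by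
    have hsub : parabolicCylinder 1 (0 : ℝ × EuclideanSpace ℝ (Fin 3)) ⊆ Iio (0 : ℝ) ×ˢ (univ : Set (EuclideanSpace ℝ (Fin 3))) := by
      intro z hz
      rw [SuitableCompactness.mem_parabolicCylinder_zero] at hz
      exact ⟨hz.1.2, mem_univ _⟩
    refine lt_of_le_of_lt (typeIBound_mono hsub) ?_
    rw [hIn]; exact hI
  -- ## (5) the inputs of the zoom-in extraction on `𝒞 × (−1, 0) ⊆ Q(0, 2)`
  have hsqrt2 : Real.sqrt 2 ≤ 2 := by
    rw [Real.sqrt_le_left (by norm_num)]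
    norm_num
  have hPQ : parCyl (0 : ℝ × EuclideanSpace ℝ (Fin 3)) 1 ⊆
      parabolicCylinder 2 (0 : ℝ × EuclideanSpace ℝ (Fin 3)) := by
    intro z hz
    obtain ⟨ht, hx⟩ := hz
    have hx' := spaceCyl_subset_ball (0 : EuclideanSpace ℝ (Fin 3)) zero_le_one hx
    rw [mul_one, mem_ball_zero_iff] at hx'
    simp only [Prod.fst_zero, one_pow, zero_sub, mem_Ioo] at ht
    rw [SuitableCompactness.mem_parabolicCylinder_zero]
    exact ⟨⟨by linarith [ht.1], ht.2⟩, lt_of_lt_of_le hx' hsqrt2⟩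
  have hle : parCylOpens (0 : ℝ × EuclideanSpace ℝ (Fin 3)) 1 ≤
      parabolicCylinderOpens 2 (0 : ℝ × EuclideanSpace ℝ (Fin 3)) := fun z hz => hPQ hz
  have hsw3 : IsSuitableWeakSolutionOn (parCylOpens (0 : ℝ × EuclideanSpace ℝ (Fin 3)) 1) 1 0 v πn :=
    IsSuitableWeakSolutionOn.mono_holds hball'.1 hle
  have hA3 : ∃ Cc : ℝ≥0, ∀ᵐ t ∂(volume.restrict (Ioo (-1 : ℝ) 0)),
      ∫⁻ x in spaceCyl (0 : EuclideanSpace ℝ (Fin 3)) 1, ‖v t x‖ₑ ^ 2 ≤ Cc := by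
    obtain ⟨Cc, hCc⟩ := hball'.2.1
    refine ⟨Cc, ?_⟩
    have hsub : Ioo (-1 : ℝ) 0 ⊆ Ioo ((0 : ℝ × EuclideanSpace ℝ (Fin 3)).1 - 2 ^ 2)
        (0 : ℝ × EuclideanSpace ℝ (Fin 3)).1 := by
      intro t ht
      simp only [Prod.fst_zero, zero_sub, mem_Ioo]
      exact ⟨by linarith [ht.1], ht.2⟩
    have hballsub : spaceCyl (0 : EuclideanSpace ℝ (Fin 3)) 1 ⊆
        ball (0 : ℝ × EuclideanSpace ℝ (Fin 3)).2 2 := by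
      refine (spaceCyl_subset_ball (0 : EuclideanSpace ℝ (Fin 3)) zero_le_one).trans ?_
      rw [mul_one, Prod.snd_zero]
      exact ball_subset_ball hsqrt2
    filter_upwards [ae_restrict_of_ae_restrict_of_subset hsub hCc] with t ht
    exact (lintegral_mono_set hballsub).trans ht
  have hG3 : HasWeakSpatialGradientOn (parCylOpens (0 : ℝ × EuclideanSpace ℝ (Fin 3)) 1) v H :=
    hH0.mono hle
  have hE3 : ∫⁻ z in parCyl (0 : ℝ × EuclideanSpace ℝ (Fin 3)) 1,
      ENNReal.ofReal (frobeniusNormSq (H z.1 z.2)) < ∞ := by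
    obtain ⟨H', hH', hH'2⟩ := hball'.2.2.1
    have hae := hH0.ae_eq hH'
    rw [coe_parabolicCylinderOpens] at hae
    refine lt_of_le_of_lt (lintegral_mono_set hPQ) ?_
    have e : ∫⁻ z in parabolicCylinder 2 (0 : ℝ × EuclideanSpace ℝ (Fin 3)),
        ENNReal.ofReal (frobeniusNormSq (H z.1 z.2)) =
        ∫⁻ z in parabolicCylinder 2 (0 : ℝ × EuclideanSpace ℝ (Fin 3)),
        ENNReal.ofReal (frobeniusNormSq (H' z.1 z.2)) := by
      refine lintegral_congr_ae ?_
      filter_upwards [hae] with z hz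
      have hz' : H z.1 z.2 = H' z.1 z.2 := hz
      rw [hz']
    rw [e]
    exact hH'2
  have hp3 : ∫⁻ z in parCyl (0 : ℝ × EuclideanSpace ℝ (Fin 3)) 1,
      ‖πn z.1 z.2‖ₑ ^ (3 / 2 : ℝ) < ∞ := by
    obtain ⟨h32, h32', h32r⟩ := threeHalves_facts
    have hm : MemLp (uncurry πn) (3 / 2)
        (volume.restrict (parabolicCylinder 2 (0 : ℝ × EuclideanSpace ℝ (Fin 3)))) := hball'.2.2.2
    have h2 := hm.2
    rw [eLpNorm_eq_lintegral_rpow_enorm_toReal (by norm_num) h32', h32r] at h2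
    have hfin : ∫⁻ z in parabolicCylinder 2 (0 : ℝ × EuclideanSpace ℝ (Fin 3)),
        ‖uncurry πn z‖ₑ ^ (3 / 2 : ℝ) < ∞ := by
      by_contra htop
      rw [not_lt, top_le_iff] at htop
      rw [htop, ENNReal.top_rpow_of_pos (by norm_num)] at h2
      exact lt_irrefl _ h2
    exact lt_of_le_of_lt (lintegral_mono_set hPQ) hfin

  have hI3 : Seregin2020.blowupIndex 0 v H < ∞ := by
    refine lt_of_le_of_lt (Seregin2020.blowupIndex_le_limsup_cknC 0 v H) (lt_of_le_of_lt ?_ hI')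
    refine limsup_le_of_le (by isBoundedDefault) ?_
    filter_upwards [Ioo_mem_nhdsGT (zero_lt_one' ℝ)] with r hr
    exact cknC_le_abScaledSum.trans (abScaledSum_le_typeIBound hr.1
      (SuitableCompactness.parabolicCylinder_zero_mono hr.1.le hr.2.le))
  -- ## (6) Seregin's zoom-in extraction ALONG the prescribed scales (floor `κ₀ = 0`)
  have hκ₀ : ∀ r ∈ Ioc (0 : ℝ) 1, ENNReal.ofReal (0 : ℝ) ≤ cknC r (0 : ℝ × EuclideanSpace ℝ (Fin 3)) v :=
    fun r _ => by rw [ENNReal.ofReal_zero]; exact bot_le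
  obtain ⟨φ, w, ϖ, hφ, hsingw, hlimw⟩ :=
    Seregin2020.exists_ancientLimit_along hsw3 hA3 hG3 hE3 hp3 hsing' hI3 one_pos hκ₀ hμ hμ0
  -- ## (7) identification: on every `Q(0,r)` the `L³` limit `w` equals the pointwise limit `W` a.e.
  intro r hr
  obtain ⟨-, hwLp, hL3, -, -⟩ := hlimw r hr
  have hQO : parabolicCylinder r (0 : ℝ × EuclideanSpace ℝ (Fin 3)) ⊆
      Iio (0 : ℝ) ×ˢ (univ : Set (EuclideanSpace ℝ (Fin 3))) := by
    intro z hz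
    rw [SuitableCompactness.mem_parabolicCylinder_zero] at hz
    exact ⟨hz.1.2, mem_univ _⟩
  have hQm : MeasurableSet (parabolicCylinder r (0 : ℝ × EuclideanSpace ℝ (Fin 3))) :=
    (isOpen_parabolicCylinder r _).measurableSet
  -- the zooms are continuous on the open slab, hence a.e. strongly measurable on the cylinder
  have hzoom_eq : ∀ j, uncurry ((μ (φ j)) • stPull ((μ (φ j)) ^ 2) (μ (φ j)) (0 : ℝ)
      (0 : EuclideanSpace ℝ (Fin 3)) v) = uncurry (nsRescale (μ (φ j)) v) := by
    intro j
    funext z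
    simp only [uncurry, smul_stPull_apply, nsRescale_apply, zero_add]
  have hmeas : ∀ j, AEStronglyMeasurable (uncurry ((μ (φ j)) • stPull ((μ (φ j)) ^ 2) (μ (φ j)) (0 : ℝ)
      (0 : EuclideanSpace ℝ (Fin 3)) v))
      (volume.restrict (parabolicCylinder r (0 : ℝ × EuclideanSpace ℝ (Fin 3)))) := by
    intro j
    rw [hzoom_eq]
    have hc : ContinuousOn (uncurry (nsRescale (μ (φ j)) v)) (Iio (0 : ℝ) ×ˢ (univ : Set (EuclideanSpace ℝ (Fin 3)))) := by
      have hφc : Continuous fun p : ℝ × EuclideanSpace ℝ (Fin 3) => ((μ (φ j)) ^ 2 * p.1, (μ (φ j)) • p.2) :=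
        (continuous_const.mul continuous_fst).prodMk (continuous_snd.const_smul (μ (φ j)))
      have hmaps : MapsTo (fun p : ℝ × EuclideanSpace ℝ (Fin 3) => ((μ (φ j)) ^ 2 * p.1, (μ (φ j)) • p.2))
          (Iio (0 : ℝ) ×ˢ (univ : Set (EuclideanSpace ℝ (Fin 3)))) (Iio (0 : ℝ) ×ˢ univ) := by
        intro p hp
        obtain ⟨h1, -⟩ := mem_prod.1 hp
        exact mem_prod.2 ⟨mul_neg_of_pos_of_neg (pow_pos (hμ _) 2) h1, mem_univ _⟩
      exact ((hcont.comp hφc.continuousOn hmaps).const_smul (μ (φ j))).congr fun p _ => rfl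
    exact (hc.mono hQO).aestronglyMeasurable hQm
  have hInM := tendstoInMeasure_of_tendsto_eLpNorm (by norm_num : (3 : ℝ≥0∞) ≠ 0) hmeas hwLp.1 hL3
  obtain ⟨ns, hns, hae⟩ := hInM.exists_seq_tendsto_ae
  -- pointwise, the same subsequence converges to `W` on the cylinder
  have haeW : ∀ᵐ z ∂(volume.restrict (parabolicCylinder r (0 : ℝ × EuclideanSpace ℝ (Fin 3)))),
      uncurry w z = uncurry W z := by
    filter_upwards [hae, ae_restrict_mem hQm] with z hz hzQ
    have hz0 : z.1 < 0 := (mem_prod.1 (hQO hzQ)).1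
    have h2 : Tendsto (fun i => uncurry ((μ (φ (ns i))) • stPull ((μ (φ (ns i))) ^ 2) (μ (φ (ns i))) (0 : ℝ)
        (0 : EuclideanSpace ℝ (Fin 3)) v) z) atTop (𝓝 (uncurry W z)) := by
      have h := ((hcv z.1 hz0 z.2).comp hφ.tendsto_atTop).comp hns.tendsto_atTop
      refine h.congr fun i => ?_
      simp only [Function.comp, uncurry, smul_stPull_apply, nsRescale_apply, zero_add]
    exact tendsto_nhds_unique hz h2
  rw [← eLpNorm_congr_ae haeW]
  exact hsingw r hr

end Summit.NavierStokesRegularity.NavierStokesRegularity.Theorems.AxisTwistDoorSignConeZoomSingular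

end
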